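import Mathlib
import Literature.Probability.Percolation.SmoothedWhiteNoise

/-!
# Gaussian kernel estimates for the white-noise coupling

Helper file for item `NoiseDiscretisation` (stmt-CriticalPhenomena-4598) of route
`CardyWhiteToColoured` (`CardyFormulaZ2`). Elementary estimates on the Gaussian kernel
`gaussWeight ℓ v = exp(−‖v‖²/(2ℓ²))` (the smoothing kernel of the route) used in the `L²` bound of
the discrepancy between the smoothed lattice noise and the smoothed continuum noise:

* `gaussWeight_sq`, `gaussWeight_le_one`, the derivative `hasFDerivAt_gaussWeight` and the bound
  `‖∇K(w)‖ ≤ ℓ⁻¹ exp(−‖w‖²/(4ℓ²))`;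
* the **Lipschitz-with-decay** estimate `abs_gaussWeight_sub_le`: for `‖y − m‖ ≤ δ/2 ≤ ℓ/2`,
  `|K(m − x) − K(y − x)| ≤ (δ/ℓ) exp(−‖y − x‖²/(8ℓ²))` (mean value theorem on the segment);
* the **shifted envelope** `exp_neg_sq_le_of_norm_le_add`: `‖b‖ ≤ ‖a‖ + d`, `0 ≤ d ≤ ℓ` imply
  `exp(−‖a‖²/ℓ²) ≤ e · exp(−‖b‖²/(2ℓ²))`;
* **Gaussian integrals over `ℂ`**: `∫ exp(−‖v − x‖²/c) dv = π c` and integrability.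

References: S. Muirhead, H. Vanneuville, Ann. Inst. H. Poincaré Probab. Stat. 56 (2020), §3
(comparison of discretised and continuum fields); standard calculus.
-/

noncomputable section

namespace Summit.CriticalPhenomena.CardyFormulaZ2.Theorems

namespace WhiteToColoured

open Set Metric MeasureTheory Filter Topology Real
open Literature.Probability.Percolation

/-! ### Pointwise facts -/

/-- `K ≤ 1`. -/
theorem gaussWeight_le_one (ℓ : ℝ) (v : ℂ) : gaussWeight ℓ v ≤ 1 := by
  rw [gaussWeight]
  apply Real.exp_le_one_iff.2
  apply div_nonpos_of_nonpos_of_nonneg (neg_nonpos.2 (sq_nonneg _)) (by positivity)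

/-- `K² (v) = exp(−‖v‖²/ℓ²)`. -/
theorem gaussWeight_sq (ℓ : ℝ) (v : ℂ) : gaussWeight ℓ v ^ 2 = Real.exp (-‖v‖ ^ 2 / ℓ ^ 2) := by
  rw [gaussWeight, ← Real.exp_nat_mul]
  congr 1
  push_cast
  ring

/-- `K(v)² ≤ exp(−‖v‖²/(2ℓ²))` (a weaker decay, convenient as a common envelope). -/
theorem gaussWeight_sq_le {ℓ : ℝ} (hℓ : 0 < ℓ) (v : ℂ) :
    gaussWeight ℓ v ^ 2 ≤ Real.exp (-‖v‖ ^ 2 / (2 * ℓ ^ 2)) := by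
  rw [gaussWeight_sq]
  apply Real.exp_le_exp.2
  rw [neg_div, neg_div, neg_le_neg_iff]
  apply div_le_div_of_nonneg_left (sq_nonneg _) (by positivity)
  nlinarith [sq_nonneg ℓ]

/-- **Derivative of the Gaussian kernel**: `∇K(v) = −K(v) ℓ⁻² ⟪v, ·⟫`. -/
theorem hasFDerivAt_gaussWeight (ℓ : ℝ) (v : ℂ) :
    HasFDerivAt (gaussWeight ℓ) ((-(gaussWeight ℓ v) / ℓ ^ 2) • innerSL ℝ v) v := by
  have h1 : HasFDerivAt (fun w : ℂ => ‖w‖ ^ 2) (2 • innerSL ℝ v) v :=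
    (hasStrictFDerivAt_norm_sq v).hasFDerivAt
  have h2 := h1.neg.mul_const (1 / (2 * ℓ ^ 2))
  have h3 := h2.exp
  have hfun : gaussWeight ℓ = fun w : ℂ => Real.exp (-(‖w‖ ^ 2) * (1 / (2 * ℓ ^ 2))) := by
    funext w; rw [gaussWeight]; congr 1; ring
  rw [hfun]
  refine h3.congr_fderiv ?_
  ext w
  simp only [smul_apply, smul_eq_mul, neg_apply, Pi.neg_apply, nsmul_eq_mul, Nat.cast_ofNat]
  ring

/-- `t exp(−t²/2) ≤ exp(−t²/4)` for `t ≥ 0` (since `t ≤ 1 + t²/4 ≤ exp(t²/4)`). -/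
theorem mul_exp_neg_sq_le (t : ℝ) : t * Real.exp (-t ^ 2 / 2) ≤ Real.exp (-t ^ 2 / 4) := by
  have h1 : t ≤ Real.exp (t ^ 2 / 4) := by
    have := Real.add_one_le_exp (t ^ 2 / 4)
    nlinarith [sq_nonneg (t / 2 - 1)]
  have h2 : Real.exp (-t ^ 2 / 2) = Real.exp (-t ^ 2 / 4) * Real.exp (-t ^ 2 / 4) := by
    rw [← Real.exp_add]; congr 1; ring
  have h3 : Real.exp (t ^ 2 / 4) * Real.exp (-t ^ 2 / 4) = 1 := by
    rw [← Real.exp_add, show t ^ 2 / 4 + -t ^ 2 / 4 = 0 by ring, Real.exp_zero]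
  calc t * Real.exp (-t ^ 2 / 2) = t * Real.exp (-t ^ 2 / 4) * Real.exp (-t ^ 2 / 4) := by
        rw [h2]; ring
    _ ≤ Real.exp (t ^ 2 / 4) * Real.exp (-t ^ 2 / 4) * Real.exp (-t ^ 2 / 4) := by
        gcongr
    _ = Real.exp (-t ^ 2 / 4) := by rw [h3, one_mul]

/-- **Norm of the gradient of the Gaussian kernel**: `K(w)‖w‖/ℓ² ≤ ℓ⁻¹ exp(−‖w‖²/(4ℓ²))`. -/
theorem gaussWeight_mul_norm_div_le {ℓ : ℝ} (hℓ : 0 < ℓ) (w : ℂ) :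
    gaussWeight ℓ w * ‖w‖ / ℓ ^ 2 ≤ 1 / ℓ * Real.exp (-‖w‖ ^ 2 / (4 * ℓ ^ 2)) := by
  have h := mul_exp_neg_sq_le (‖w‖ / ℓ)
  have e1 : -(‖w‖ / ℓ) ^ 2 / 2 = -(‖w‖ ^ 2) / (2 * ℓ ^ 2) := by field_simp
  have e2 : -(‖w‖ / ℓ) ^ 2 / 4 = -‖w‖ ^ 2 / (4 * ℓ ^ 2) := by field_simp
  rw [e1, e2] at h
  rw [gaussWeight]
  calc Real.exp (-‖w‖ ^ 2 / (2 * ℓ ^ 2)) * ‖w‖ / ℓ ^ 2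
      = 1 / ℓ * (‖w‖ / ℓ * Real.exp (-‖w‖ ^ 2 / (2 * ℓ ^ 2))) := by field_simp
    _ ≤ 1 / ℓ * Real.exp (-‖w‖ ^ 2 / (4 * ℓ ^ 2)) := by gcongr

/-- The operator norm of the derivative of the Gaussian kernel. -/
theorem norm_fderiv_gaussWeight_le {ℓ : ℝ} (hℓ : 0 < ℓ) (w : ℂ) :
    ‖(-(gaussWeight ℓ w) / ℓ ^ 2) • innerSL ℝ w‖ ≤ 1 / ℓ * Real.exp (-‖w‖ ^ 2 / (4 * ℓ ^ 2)) := by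
  rw [norm_smul, innerSL_apply_norm, Real.norm_eq_abs, abs_div, abs_neg,
    abs_of_pos (gaussWeight_pos ℓ w), abs_of_pos (by positivity : (0 : ℝ) < ℓ ^ 2)]
  have := gaussWeight_mul_norm_div_le hℓ w
  calc gaussWeight ℓ w / ℓ ^ 2 * ‖w‖ = gaussWeight ℓ w * ‖w‖ / ℓ ^ 2 := by ring
    _ ≤ _ := this

/-- **Shifted envelope**: if `‖b‖ ≤ ‖a‖ + d` with `0 ≤ d ≤ ℓ`, then
`exp(−‖a‖²/ℓ²) ≤ e · exp(−‖b‖²/(2ℓ²))`. -/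
theorem exp_neg_sq_le_of_norm_le_add {ℓ d : ℝ} (hℓ : 0 < ℓ) (hd : 0 ≤ d) (hdℓ : d ≤ ℓ) {a b : ℂ}
    (hab : ‖b‖ ≤ ‖a‖ + d) :
    Real.exp (-‖a‖ ^ 2 / ℓ ^ 2) ≤ Real.exp 1 * Real.exp (-‖b‖ ^ 2 / (2 * ℓ ^ 2)) := by
  rw [← Real.exp_add]
  apply Real.exp_le_exp.2
  -- `‖b‖² ≤ 2‖a‖² + 2d²` and `d² ≤ ℓ²`
  have h1 : ‖b‖ ^ 2 ≤ 2 * ‖a‖ ^ 2 + 2 * d ^ 2 := by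
    nlinarith [sq_nonneg (‖a‖ - d), norm_nonneg a, norm_nonneg b]
  have h2 : d ^ 2 ≤ ℓ ^ 2 := by nlinarith
  have hℓ2 : 0 < ℓ ^ 2 := by positivity
  rw [div_le_iff₀ hℓ2] at *
  have : (1 + -‖b‖ ^ 2 / (2 * ℓ ^ 2)) * ℓ ^ 2 = ℓ ^ 2 - ‖b‖ ^ 2 / 2 := by
    field_simp; ring
  rw [this]
  nlinarith

/-- **Displacement inside a cell**: if `‖y − m‖ ≤ d`, `0 ≤ d ≤ ℓ`, then
`K(m − x)² ≤ e · exp(−‖y − x‖²/(2ℓ²))`. -/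
theorem gaussWeight_sq_le_of_norm_sub_le {ℓ d : ℝ} (hℓ : 0 < ℓ) (hd : 0 ≤ d) (hdℓ : d ≤ ℓ)
    {x m y : ℂ} (hym : ‖y - m‖ ≤ d) :
    gaussWeight ℓ (m - x) ^ 2 ≤ Real.exp 1 * Real.exp (-‖y - x‖ ^ 2 / (2 * ℓ ^ 2)) := by
  rw [gaussWeight_sq]
  refine exp_neg_sq_le_of_norm_le_add hℓ hd hdℓ ?_
  calc ‖y - x‖ = ‖(m - x) + (y - m)‖ := by congr 1; ring
    _ ≤ ‖m - x‖ + ‖y - m‖ := norm_add_le _ _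
    _ ≤ ‖m - x‖ + d := by linarith

/-- **Two points of a cell**: if `‖y − y'‖ ≤ d`, `0 ≤ d ≤ ℓ`, then
`K(y − x)² ≤ e · exp(−‖y' − x‖²/(2ℓ²))`. -/
theorem gaussWeight_sq_le_of_norm_sub_le' {ℓ d : ℝ} (hℓ : 0 < ℓ) (hd : 0 ≤ d) (hdℓ : d ≤ ℓ)
    {x y y' : ℂ} (hyy : ‖y' - y‖ ≤ d) :
    gaussWeight ℓ (y - x) ^ 2 ≤ Real.exp 1 * Real.exp (-‖y' - x‖ ^ 2 / (2 * ℓ ^ 2)) :=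
  gaussWeight_sq_le_of_norm_sub_le hℓ hd hdℓ hyy

/-- **Lipschitz-with-decay estimate of the Gaussian kernel**: if `‖y − m‖ ≤ δ/2` with
`0 < δ ≤ ℓ`, then `|K(m − x) − K(y − x)| ≤ (δ/ℓ) exp(−‖y − x‖²/(8ℓ²))`. -/
theorem abs_gaussWeight_sub_le {ℓ δ : ℝ} (hℓ : 0 < ℓ) (hδ : 0 < δ) (hδℓ : δ ≤ ℓ) {x m y : ℂ}
    (hym : ‖y - m‖ ≤ δ / 2) :
    |gaussWeight ℓ (m - x) - gaussWeight ℓ (y - x)| ≤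
      δ / ℓ * Real.exp (-‖y - x‖ ^ 2 / (8 * ℓ ^ 2)) := by
  -- mean value theorem on the segment from `y - x` to `m - x`
  set a : ℂ := y - x with ha
  set b : ℂ := m - x with hb
  have hab : ‖b - a‖ ≤ δ / 2 := by
    rw [hb, ha, show m - x - (y - x) = -(y - m) by ring, norm_neg]; exact hym
  set C := 1 / ℓ * (Real.exp (1 / 16) * Real.exp (-‖a‖ ^ 2 / (8 * ℓ ^ 2))) with hC
  -- the derivative bound on the segment
  have hbound : ∀ w ∈ segment ℝ a b, ‖(-(gaussWeight ℓ w) / ℓ ^ 2) • innerSL ℝ w‖ ≤ C := by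
    intro w hw
    refine (norm_fderiv_gaussWeight_le hℓ w).trans ?_
    rw [hC]
    gcongr
    -- `‖w‖ ≥ ‖a‖ - δ/2`, so `exp(-‖w‖²/(4ℓ²)) ≤ exp(1/16) exp(-‖a‖²/(8ℓ²))`
    have hwa : ‖a‖ ≤ ‖w‖ + δ / 2 := by
      have h1 : dist w a ≤ dist b a := by
        have hsub : segment ℝ a b ⊆ closedBall a (dist b a) :=
          (convex_closedBall a (dist b a)).segment_subset (mem_closedBall_self dist_nonneg)
            (mem_closedBall.2 le_rfl)
        exact mem_closedBall.1 (hsub hw)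
      rw [dist_eq_norm, dist_eq_norm] at h1
      calc ‖a‖ = ‖w - (w - a)‖ := by congr 1; ring
        _ ≤ ‖w‖ + ‖w - a‖ := norm_sub_le _ _
        _ ≤ ‖w‖ + δ / 2 := by linarith
    rw [← Real.exp_add]
    apply Real.exp_le_exp.2
    have h1 : ‖a‖ ^ 2 ≤ 2 * ‖w‖ ^ 2 + 2 * (δ / 2) ^ 2 := by
      nlinarith [sq_nonneg (‖w‖ - δ / 2), norm_nonneg w, norm_nonneg a]
    have h2 : (δ / 2) ^ 2 ≤ ℓ ^ 2 / 4 := by nlinarith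
    have hℓ2 : 0 < ℓ ^ 2 := by positivity
    have e1 : -‖w‖ ^ 2 / (4 * ℓ ^ 2) = (-‖w‖ ^ 2 / 4) / ℓ ^ 2 := by field_simp
    have e2 : 1 / 16 + -‖a‖ ^ 2 / (8 * ℓ ^ 2) = (ℓ ^ 2 / 16 - ‖a‖ ^ 2 / 8) / ℓ ^ 2 := by
      field_simp; ring
    rw [e1, e2, div_le_div_iff_of_pos_right hℓ2]
    nlinarith
  have hmvt := (convex_segment a b).norm_image_sub_le_of_norm_hasFDerivWithin_le
    (f := gaussWeight ℓ) (fun w _ => (hasFDerivAt_gaussWeight ℓ w).hasFDerivWithinAt) hbound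
    (left_mem_segment ℝ a b) (right_mem_segment ℝ a b)
  rw [Real.norm_eq_abs] at hmvt
  refine hmvt.trans ?_
  rw [hC]
  have hexp : Real.exp (1 / 16) ≤ 2 := by
    have h2 : (1 : ℝ) / 16 ≤ Real.log 2 := by have := Real.log_two_gt_d9; linarith
    have := Real.exp_le_exp.2 h2
    rwa [Real.exp_log two_pos] at this
  have hpos : 0 ≤ Real.exp (-‖a‖ ^ 2 / (8 * ℓ ^ 2)) := (Real.exp_pos _).le
  calc 1 / ℓ * (Real.exp (1 / 16) * Real.exp (-‖a‖ ^ 2 / (8 * ℓ ^ 2))) * ‖b - a‖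
      ≤ 1 / ℓ * (2 * Real.exp (-‖a‖ ^ 2 / (8 * ℓ ^ 2))) * (δ / 2) := by
        gcongr
    _ = δ / ℓ * Real.exp (-‖a‖ ^ 2 / (8 * ℓ ^ 2)) := by field_simp

/-! ### Gaussian integrals over `ℂ` -/

/-- `∫ exp(−b ‖v‖²) dv = π / b` over `ℂ`. -/
theorem integral_exp_neg_mul_sq_norm_complex {b : ℝ} (hb : 0 < b) :
    ∫ v : ℂ, Real.exp (-b * ‖v‖ ^ 2) = π / b := by
  have h := GaussianFourier.integral_rexp_neg_mul_sq_norm (V := ℂ) hb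
  rw [Complex.finrank_real_complex] at h
  norm_num at h
  simpa only [neg_mul] using h

/-- `∫ exp(−‖v − x‖²/c) dv = π c` over `ℂ`, for `c > 0`. -/
theorem integral_exp_neg_sq_norm_sub_div {c : ℝ} (hc : 0 < c) (x : ℂ) :
    ∫ v : ℂ, Real.exp (-‖v - x‖ ^ 2 / c) = π * c := by
  have h1 : (fun v : ℂ => Real.exp (-‖v - x‖ ^ 2 / c)) =
      fun v => (fun w : ℂ => Real.exp (-(1 / c) * ‖w‖ ^ 2)) (v - x) := by
    funext v; congr 1; field_simp
  rw [h1, integral_sub_right_eq_self (μ := volume) (fun w : ℂ => Real.exp (-(1 / c) * ‖w‖ ^ 2)) x,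
    integral_exp_neg_mul_sq_norm_complex (by positivity)]
  field_simp

/-- The shifted Gaussian `v ↦ exp(−‖v − x‖²/c)` is integrable over `ℂ` (`c > 0`). -/
theorem integrable_exp_neg_sq_norm_sub_div {c : ℝ} (hc : 0 < c) (x : ℂ) :
    Integrable fun v : ℂ => Real.exp (-‖v - x‖ ^ 2 / c) := by
  refine Integrable.of_integral_ne_zero ?_
  rw [integral_exp_neg_sq_norm_sub_div hc x]
  positivity

/-- The shifted Gaussian is non-negative and measurable (for `lintegral` manipulations). -/
theorem measurable_exp_neg_sq_norm_sub_div (c : ℝ) (x : ℂ) :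
    Measurable fun v : ℂ => Real.exp (-‖v - x‖ ^ 2 / c) := by
  fun_prop

/-- `∫⁻ exp(−‖v − x‖²/c) dv = π c` as an extended non-negative real. -/
theorem lintegral_exp_neg_sq_norm_sub_div {c : ℝ} (hc : 0 < c) (x : ℂ) :
    ∫⁻ v : ℂ, ENNReal.ofReal (Real.exp (-‖v - x‖ ^ 2 / c)) = ENNReal.ofReal (π * c) := by
  rw [← integral_exp_neg_sq_norm_sub_div hc x,
    ofReal_integral_eq_lintegral_ofReal (integrable_exp_neg_sq_norm_sub_div hc x)
      (Eventually.of_forall fun v => (Real.exp_pos _).le)]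

end WhiteToColoured

end Summit.CriticalPhenomena.CardyFormulaZ2.Theorems
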